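/-
Copyright (c) 2026 the pub-hodgecm-mathlib formalisation cell (harness21).  Prover seat hodgecm-mathlib-F0P3a-p03 (g17): «S3-ram» seeding wave (LEAD F0P3a-plan (g12)
T11-41∕T11-76; owner F0P3a-p06 (g15)), row «(α₂) (f)-ram TWO-CLASSES ASSEMBLY (place-generic)», FILE 2∕2; 2026-09-01.
-/
import Literature.NumberTheory.Rogawski1990.LocalNormPairOfSimilitudeFrame                         -- FILE 1∕2 (this seat): ★-to-be `exists_isLocalNormPair_of_frame`; brings ★ `…StubFrame` (`mul_eq_mul_reindex_fromBlocks_of_conj_endoEmbLocal_eq`), ★ `…IrredClauseOfValues` (support, `hirr` bridge), ★ `…KappaCountTypeTwo` (the two classes)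
import Literature.NumberTheory.Rogawski1990.LocalStableClassesNonsplitTypeTwoKappa              -- ★ `exists_isStablyConj_finKappaAt_eq_neg`, ★ `finKappaAt_eq_iff_isConj`
import Literature.NumberTheory.Automorphic.LocalRegularOrbitClosed                               -- ★ `map_conjLocal_transpose_localForm`, ★ `isUnit_det_localForm`
import Literature.LinearAlgebra.Matrix.BlockCentralizerDisjointSpectra                           -- ★ `eval_charpoly_ne_zero_of_irreducible`
import HarnessLib

/-!
# The `G′`-side of a type-(2) clause on its TWO classes — PLACE-GENERIC (non-split `v`, ramified allowed), the factor `τ_v · D_v` and the sign `κ_v` SYMBOLIC: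
# `∑ᶠ c, Δ‴_v(γ_H, out c)·Φ(c, f) = τ_v(γ_H, μ)·D_v(γ_H)·(Φ(c₊, f) − Φ(c₋, f))` (Rogawski 1990 (4.3.1)–(4.3.2), Prop. 3.5.2 (c); Flicker 1998 Thm. 18)

Topic `NumberTheory/Rogawski1990`; namespace `Literature.NumberTheory.Rogawski1990`.  THEOREMS ONLY (no definition, no named fact, no instance, no notation, no `sorry`).
Cell `pub/hodgecm-mathlib`, crux H413 (`--supports stmt-HodgeConjecture-24833`), «S3-ram» seeding wave (Literature seeding, count-neutral), the type-(2) population of the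
ramified fold's join socket (fold v7 §1a `stub_typeOneTwoRowsJoin_ram`, conjunct (T2); architect (α₂) A-p12 (g23), G-side counts F0P3a-p07 (g13)).

This file is the TYPE-(2) twin of ★ `finsum_delta_mul_classOrbitalIntegral_eq_mul_sum_kappa_of_four_representatives` (F0P3b-p01 (g13), the type-(1) four classes,
place-generic) and the PLACE-GENERIC re-cut of ★ `finsum_delta_mul_classOrbitalIntegral_eq_of_irreducible` (B-p14 (g30)), whose only inert inputs
(`hunr : v` unramified in `L`, `hμ : μ` unramified at `w`) served to EVALUATE the common factor as `(−q_v)^{−ord_w χ_g(u)}` (★ (D2)).  Here the factor is kept SYMBOLIC: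
by DEFINITION (★ `finExplicitDelta_of_isLocalNormPair`) `Δ‴_v(γ_H, γ′) = τ_v(γ_H, μ)·D_v(γ_H)·κ_v(γ_H, γ′)` on matched pairs at EVERY place, so the two-class sum factors
through `τ_v·D_v` whatever its value — at a tame-ramified `w` it is read by the Δ‴-ram dialect (★ `FinExplicitTransferFactorDeepValueRamified` ∕ ★ `FinExplicitTransferFactorRamifiedLiterals`).

THE MATHEMATICS.  `v` a finite place of `L⁺` NOT split in the CM field `L` (`w ∣ v`, `c • w = w`), `γ_H = (g, u) ∈ H_v = U(Φ₂) × U(Φ₁)` whose `U(Φ₂)`-component has a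
characteristic polynomial WITHOUT ROOT in `L_w` (the line's token `hirr`; Flicker's torus `(EL)¹ × E¹`).  For a match `ι_v(γ_H) ↔ γ′ = b` the local stable class of `b`
consists of exactly TWO `G′_v`-classes `c₀ ∋ b`, `c₁`, with `κ_v(γ_H, c₁) = −κ_v(γ_H, c₀)`, `κ_v = ±1` (★ `exists_conjClassesIn_eq_two_finKappaAt`, ★ `finKappaAt_eq_one_or_eq_neg_one_of_isUnit`;
`χ_g(u)` is automatically a unit since `χ_g` is irreducible over the field `L_v`); `Δ‴_v(γ_H, ·)` is supported on them (★ `mk_mem_conjClassesIn_of_finExplicitDelta_ne_zero`) and equals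
`τ_v(γ_H, μ)·D_v(γ_H)·κ_v(γ_H, ·)` there.  Hence, for ANY orbital-measure family and ANY `f`,
`∑ᶠ c, Δ‴_v(γ_H, out c)·Φ(c, f) = τ_v(γ_H, μ)·D_v(γ_H)·(Φ(c₊, f) − Φ(c₋, f))`, `c_±` the classes of sign `±1`.

* §1 **`finsum_delta_mul_classOrbitalIntegral_eq_mul_sub_of_blockFrame_of_values`** — VALUES form over a block-framed match (the template's shape, minus `hunr hμ hμω`).
* §2 **`exists_signedPair_finsum_delta_mul_classOrbitalIntegral_eq_mul_sub`** — `γ_H`-KEYED form: from ONE match `b` and `hirr` alone, the signed pair `(δ₊, δ₋)` of matches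
  (`κ_v = 1`, `κ_v = −1`), exhaustion of the matches by the two classes, and the identity `∑ᶠ c, Δ‴·Φ = τ_v·D_v·(Φ(⟦δ₊⟧, f) − Φ(⟦δ₋⟧, f))` for every family and every `f`;
  and the values form keyed by `γ_H` (`…_of_values`).
* §3 **`exists_signedPair_finsum_delta_mul_classOrbitalIntegral_eq_mul_sub_of_frame`** — §2 fed by the wave's integral antidiagonal frame token
  `hframe : H′_w = (−det H′_w) • ᵗ(σ_w A)·Φ₃·A` (★ p846344) through FILE 1∕2 ★ `exists_isLocalNormPair_of_frame` (the ramified-ready twin of ★ `exists_isLocalNormPair_of_nonsplit`).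
HONEST LABEL: HC_CM is proved only modulo the 2 remaining named inputs (hLiu418 24832, h413 24833) until rung 0 closes; this file is bookkeeping over ★ organs, no books consequence.

## References
* [Rogawski1990] J. D. Rogawski, *Automorphic Representations of Unitary Groups in Three Variables*, Ann. of Math. Stud. 123 (1990), §3.5 Prop. 3.5.2 (c) p. 29, §3.6 p. 31,
  §4.3 (4.3.1)–(4.3.2) p. 43, §4.9 Prop. 4.9.1 p. 55, §14.2 p. 233.
* [Flicker1998UnitaryFL] Y. Z. Flicker, *Elementary proof of the fundamental lemma for a unitary group*, Canad. J. Math. 50 (1998), Prop. 3 p. 78, Theorem 18 p. 97.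
* [Kottwitz1986] R. E. Kottwitz, *Stable trace formula: elliptic singular terms*, Math. Ann. 275 (1986), §7.
* [Jacobowitz1962] R. Jacobowitz, *Hermitian forms over local fields*, Amer. J. Math. 84 (1962), §7 Thm. 7.1.
-/

set_option autoImplicit false

noncomputable section

open NumberField IsDedekindDomain Matrix
open scoped MatrixGroups

namespace Literature.NumberTheory.Rogawski1990

open Literature.NumberTheory.Automorphic Literature.NumberTheory.Automorphic.UnitaryGroup
open Literature.NumberTheory.GaloisRepresentations Literature.NumberTheory.NumberFields Literature.NumberTheory.QuadraticForms
open Literature.AlgebraicGeometry.ShimuraVarieties (unitaryGroup mem_unitaryGroup_iff)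

section TwoClasses

variable (L : Type) [Field L] [NumberField L] [IsCMField L] (v : HeightOneSpectrum (𝓞 ↥(maximalRealSubfield L)))
  (H' : Matrix (Fin 3) (Fin 3) L)
  (a : (UnitaryGroup.cmDatum L 2 (Matrix.of fun i j : Fin 2 => if i.val + j.val + 1 = 2 then (1 : L) else 0)).Local v ×
      (UnitaryGroup.cmDatum L 1 (Matrix.of fun i j : Fin 1 => if i.val + j.val + 1 = 1 then (1 : L) else 0)).Local v)
  (b : (UnitaryGroup.cmDatum L 3 H').Local v)
  (w : UnitaryGroup.PlacesOver L v) (hw : IsCMField.complexConj L • w.1 = w.1)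

/-! ## §1 The two-classes assembly over a block-framed match, the factor `τ_v · D_v` symbolic (values form) -/

set_option maxHeartbeats 400000 in
include hw in
open scoped Classical in
/-- **THE `G′`-SIDE OF A TYPE-(2) CLAUSE FROM ITS TWO CLASSES — place-generic, `τ_v·D_v` symbolic, values form.**  `v` non-split (`c • w = w`; ramified allowed),
`γ_H = a` matched with `b` (`χ_g(u)` a unit), `b` with a block frame `b·P = P·[A 0; 0 u]`, `χ_A` irreducible.  If `Φ(⟦δ⟧, f) = X` on every matched `δ` with `κ_v(γ_H, δ) = 1`
and `= X′` on every matched `δ` with `κ_v(γ_H, δ) = −1`, then for ANY orbital-measure family and ANY `f`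
`∑ᶠ c, Δ‴_v(γ_H, out c)·Φ(c, f) = τ_v(γ_H, μ)·D_v(γ_H)·(X − X′)` — the two classes ★ `exists_conjClassesIn_eq_two_finKappaAt`, `Δ‴ = τ·D·κ` on them by ★
`finExplicitDelta_of_isLocalNormPair`, support by ★ `mk_mem_conjClassesIn_of_finExplicitDelta_ne_zero`.
[cite: Rogawski1990, §4.3 (4.3.1)–(4.3.2) p. 43; §4.9 Prop. 4.9.1 (b) p. 55; §3.5 Prop. 3.5.2 (c) p. 29] [cite: Flicker1998UnitaryFL, Theorem 18 p. 97] -/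
theorem finsum_delta_mul_classOrbitalIntegral_eq_mul_sub_of_blockFrame_of_values
    [∀ γ : (UnitaryGroup.cmDatum L 3 H').Local v,
    MeasurableSpace (((UnitaryGroup.cmDatum L 3 H').Local v) ⧸ Subgroup.centralizer ({γ} : Set ((UnitaryGroup.cmDatum L 3 H').Local v)))]
    (μ : HeckeCharacter L)
    (hl : ∀ (v : HeightOneSpectrum (𝓞 ↥(maximalRealSubfield L)))
      (a : (UnitaryGroup.cmDatum L 2 (Matrix.of fun i j : Fin 2 => if i.val + j.val + 1 = 2 then (1 : L) else 0)).Local v ×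
      (UnitaryGroup.cmDatum L 1 (Matrix.of fun i j : Fin 1 => if i.val + j.val + 1 = 1 then (1 : L) else 0)).Local v)
      (b : (UnitaryGroup.cmDatum L 3 H').Local v)
      (x : (UnitaryGroup.cmDatum L 2 (Matrix.of fun i j : Fin 2 => if i.val + j.val + 1 = 2 then (1 : L) else 0)).Local v ×
      (UnitaryGroup.cmDatum L 1 (Matrix.of fun i j : Fin 1 => if i.val + j.val + 1 = 1 then (1 : L) else 0)).Local v),
      finExplicitDelta L v H' (x * a * x⁻¹) μ b = finExplicitDelta L v H' a μ b)
    (hr : ∀ (v : HeightOneSpectrum (𝓞 ↥(maximalRealSubfield L)))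
      (a : (UnitaryGroup.cmDatum L 2 (Matrix.of fun i j : Fin 2 => if i.val + j.val + 1 = 2 then (1 : L) else 0)).Local v ×
      (UnitaryGroup.cmDatum L 1 (Matrix.of fun i j : Fin 1 => if i.val + j.val + 1 = 1 then (1 : L) else 0)).Local v)
      (b y : (UnitaryGroup.cmDatum L 3 H').Local v),
      finExplicitDelta L v H' a μ (y * b * y⁻¹) = finExplicitDelta L v H' a μ b)
    (h : IsLocalNormPair L H' v a b) (hu : IsUnit ((finCharpolyTwo L v a).eval (finGammaTwo L v a)))
    (hH : (((UnitaryGroup.adelicForm L 3 H').map (UnitaryGroup.adeleToLocal L v)).map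
      (UnitaryGroup.conjLocal L (IsCMField.complexConj L) v))ᵀ = (UnitaryGroup.adelicForm L 3 H').map (UnitaryGroup.adeleToLocal L v))
    (hHd : IsUnit ((UnitaryGroup.adelicForm L 3 H').map (UnitaryGroup.adeleToLocal L v)).det) (e : Fin 2 ⊕ Fin 1 ≃ Fin 3)
    {P : GL (Fin 3) (UnitaryGroup.LocalRing L v)} {A : Matrix (Fin 2) (Fin 2) (UnitaryGroup.LocalRing L v)}
    (hP : (b.val.val : Matrix (Fin 3) (Fin 3) (UnitaryGroup.LocalRing L v)) * P.val = P.val * reindex e e (fromBlocks A 0 0 !![finGammaTwo L v a]))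
    (hA : Irreducible A.charpoly) (mG : OrbitalMeasureFamily ((UnitaryGroup.cmDatum L 3 H').Local v))
    (f : (UnitaryGroup.cmDatum L 3 H').Local v → ℂ) {X X' : ℂ}
    (hΦ : ∀ δ : (UnitaryGroup.cmDatum L 3 H').Local v, IsLocalNormPair L H' v a δ → finKappaAt L v H' a δ = 1 →
      classOrbitalIntegral mG f (ConjClasses.mk δ) = X)
    (hΦ' : ∀ δ : (UnitaryGroup.cmDatum L 3 H').Local v, IsLocalNormPair L H' v a δ → finKappaAt L v H' a δ = -1 →
      classOrbitalIntegral mG f (ConjClasses.mk δ) = X') :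
    ∑ᶠ c : ConjClasses ((UnitaryGroup.cmDatum L 3 H').Local v),
        (finExplicitCollection L H' μ hl hr v).Δ a (Quotient.out c) * classOrbitalIntegral mG f c =
      finTau L v a μ * (finWeylRatio L v a : ℂ) * (X - X') := by
  -- the two classes and their signs
  obtain ⟨c₀, c₁, hS, hne, hκ₀, hκ₁⟩ := exists_conjClassesIn_eq_two_finKappaAt L v H' a b w hw h hu hH hHd e hP hA
  set Z : ℂ := finTau L v a μ * (finWeylRatio L v a : ℂ) with hZ
  set F : ConjClasses ((UnitaryGroup.cmDatum L 3 H').Local v) → ℂ :=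
    fun c => (finExplicitCollection L H' μ hl hr v).Δ a (Quotient.out c) * classOrbitalIntegral mG f c with hF
  -- every class reads as `⟦out c⟧`
  have hmk : ∀ c : ConjClasses ((UnitaryGroup.cmDatum L 3 H').Local v),
      ConjClasses.mk (⟨(Quotient.out c).val, (Quotient.out c).2⟩ : unitaryGroup (UnitaryGroup.conjLocal L (IsCMField.complexConj L) v)
        ((UnitaryGroup.adelicForm L 3 H').map (UnitaryGroup.adeleToLocal L v))) = c := fun c => Quotient.out_eq c
  -- support inside the pair
  have hsupp : Function.support F ⊆ ({c₀, c₁} : Set (ConjClasses ((UnitaryGroup.cmDatum L 3 H').Local v))) := by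
    intro c hc
    rw [Function.mem_support] at hc
    have hΔ : finExplicitDelta L v H' a μ (Quotient.out c) ≠ 0 := by
      intro h0
      apply hc
      simp only [hF, finExplicitCollection_Δ, h0, zero_mul]
    have hmem := mk_mem_conjClassesIn_of_finExplicitDelta_ne_zero L v H' a b μ h hΔ
    rwa [hmk, hS] at hmem
  rw [← finsum_mem_univ, finsum_mem_inter_support_eq' F Set.univ {c₀, c₁} (fun x hx => ⟨fun _ => hsupp hx, fun _ => Set.mem_univ _⟩)]
  refine (finsum_mem_pair (f := F) hne).trans ?_
  -- the value of `Δ` and of `κ` on the two classes (read on the `cmDatum` carrier, as in the goal)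
  have hval : ∀ c : ConjClasses ((UnitaryGroup.cmDatum L 3 H').Local v),
      c ∈ conjClassesIn (UnitaryGroup.conjLocal L (IsCMField.complexConj L) v)
        ((UnitaryGroup.adelicForm L 3 H').map (UnitaryGroup.adeleToLocal L v)) ⟨b.val, b.2⟩ →
      IsLocalNormPair L H' v a (Quotient.out c) ∧
        (finExplicitCollection L H' μ hl hr v).Δ a (Quotient.out c) = Z * ((finKappaAt L v H' a (Quotient.out c) : ℤ) : ℂ) ∧
        (c = c₀ → finKappaAt L v H' a (Quotient.out c) = finKappaAt L v H' a b) ∧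
        (c = c₁ → finKappaAt L v H' a (Quotient.out c) = -finKappaAt L v H' a b) := by
    intro c hc
    have hc' := hc
    rw [← hmk c] at hc'
    have hn := isLocalNormPair_of_mk_mem_conjClassesIn L v H' a b h hc'
    refine ⟨hn, ?_, fun h0 => hκ₀ _ ((hmk c).trans h0), fun h1 => hκ₁ _ ((hmk c).trans h1)⟩
    rw [finExplicitCollection_Δ, finExplicitDelta_of_isLocalNormPair L v H' a μ hn]
  have hc₀ : (c₀ : ConjClasses ((UnitaryGroup.cmDatum L 3 H').Local v)) ∈ conjClassesIn (UnitaryGroup.conjLocal L (IsCMField.complexConj L) v)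
      ((UnitaryGroup.adelicForm L 3 H').map (UnitaryGroup.adeleToLocal L v)) ⟨b.val, b.2⟩ := by rw [hS]; exact Set.mem_insert _ _
  have hc₁ : (c₁ : ConjClasses ((UnitaryGroup.cmDatum L 3 H').Local v)) ∈ conjClassesIn (UnitaryGroup.conjLocal L (IsCMField.complexConj L) v)
      ((UnitaryGroup.adelicForm L 3 H').map (UnitaryGroup.adeleToLocal L v)) ⟨b.val, b.2⟩ := by
    rw [hS]; exact Set.mem_insert_of_mem _ (Set.mem_singleton _)
  obtain ⟨hn₀, hΔ₀, hk₀, -⟩ := hval c₀ hc₀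
  obtain ⟨hn₁, hΔ₁, -, hk₁⟩ := hval c₁ hc₁
  replace hk₀ := hk₀ rfl
  replace hk₁ := hk₁ rfl
  simp only [hF]
  rw [hΔ₀, hΔ₁, hk₀, hk₁]
  -- classes read back from their representatives, on the `cmDatum` carrier
  have hmk' : ∀ c : ConjClasses ((UnitaryGroup.cmDatum L 3 H').Local v), ConjClasses.mk (Quotient.out c) = c := fun c => Quotient.out_eq c
  -- the sign of `γ′` itself
  rcases finKappaAt_eq_one_or_eq_neg_one_of_isUnit L v H' a b h hu with hκ | hκ
  · have hX : classOrbitalIntegral mG f c₀ = X := by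
      have h0 := hΦ _ hn₀ (hk₀.trans hκ)
      rwa [hmk' c₀] at h0
    have hX' : classOrbitalIntegral mG f c₁ = X' := by
      have h1 := hΦ' _ hn₁ (hk₁.trans (by rw [hκ]))
      rwa [hmk' c₁] at h1
    rw [hX, hX', hκ]
    push_cast
    ring
  · have hX' : classOrbitalIntegral mG f c₀ = X' := by
      have h0 := hΦ' _ hn₀ (hk₀.trans hκ)
      rwa [hmk' c₀] at h0
    have hX : classOrbitalIntegral mG f c₁ = X := by
      have h1 := hΦ _ hn₁ (hk₁.trans (by rw [hκ, neg_neg]))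
      rwa [hmk' c₁] at h1
    rw [hX, hX', hκ]
    push_cast
    ring

end TwoClasses

/-! ## §2 The `γ_H`-keyed form: the signed pair of matches and the two-class identity from ONE match and `hirr` -/

section Keyed

variable (L : Type) [Field L] [NumberField L] [IsCMField L] (H' : Matrix (Fin 3) (Fin 3) L)
  {v : HeightOneSpectrum (𝓞 ↥(maximalRealSubfield L))}

/-- A CM field has a non-zero element negated by complex conjugation. [cite: Rogawski1990, §1.10] -/
private theorem exists_complexConj_eq_neg_ne_zero₂ (L : Type) [Field L] [NumberField L] [IsCMField L] :
    ∃ δ : L, IsCMField.complexConj L δ = -δ ∧ δ ≠ 0 := by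
  obtain ⟨ζ, hζ⟩ := not_forall.1 fun h0 => IsCMField.complexConj_ne_one L (AlgEquiv.ext h0)
  refine ⟨ζ - IsCMField.complexConj L ζ, by rw [map_sub, IsCMField.complexConj_apply_apply, neg_sub], fun h0 => hζ ?_⟩
  rw [sub_eq_zero] at h0
  exact h0.symm

/-- **`χ_g(u)` IS A UNIT** when the `U(Φ₂)`-component of `γ_H` has characteristic polynomial without root in `L_w` (`v` non-split: `L_v = L_w` is a field, `χ_g` irreducible
of degree `2`, so `χ_g(u) ≠ 0`). [cite: Flicker1998UnitaryFL, Prop. 3 p. 78] [cite: Rogawski1990, §3.6 p. 31] -/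
theorem isUnit_eval_finCharpolyTwo_of_not_exists_isRoot (w : PlacesOver L v) (hw : IsCMField.complexConj L • w.1 = w.1)
    (γH : (cmDatum L 2 (Matrix.of fun i j : Fin 2 => if i.val + j.val + 1 = 2 then (1 : L) else 0)).Local v ×
      (cmDatum L 1 (Matrix.of fun i j : Fin 1 => if i.val + j.val + 1 = 1 then (1 : L) else 0)).Local v)
    (hirr : ¬ ∃ x : w.1.adicCompletion L, (((γH.1.val : GL (Fin 2) (LocalRing L v)).val.map
        (Pi.evalRingHom (fun w' : PlacesOver L v => w'.1.adicCompletion L) w)).charpoly).IsRoot x) :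
    IsUnit ((finCharpolyTwo L v γH).eval (finGammaTwo L v γH)) := by
  have hA : Irreducible ((γH.1.val : GL (Fin 2) (UnitaryGroup.LocalRing L v)).val.charpoly) :=
    irreducible_charpoly_of_not_exists_isRoot_eval L v w hw _ hirr
  obtain ⟨δ₁, hcδ, hδ⟩ := exists_complexConj_eq_neg_ne_zero₂ L
  have hF := Liu2021.LemD1IndexedNonVacuityNonsplitPlace.isField_localRing_of_nonsplit L v (IsCMField.complexConj L) hcδ hδ w hw
  have hne : (finCharpolyTwo L v γH).eval (finGammaTwo L v γH) ≠ 0 := by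
    letI : Field (UnitaryGroup.LocalRing L v) := hF.toField
    exact Literature.LinearAlgebra.Matrix.eval_charpoly_ne_zero_of_irreducible hA (by simp) _
  obtain ⟨y, hy⟩ := hF.mul_inv_cancel hne
  exact IsUnit.of_mul_eq_one _ hy

set_option maxHeartbeats 400000 in
open scoped Classical in
/-- **THE SIGNED PAIR OF MATCHES OF A TYPE-(2) `γ_H` AND THE TWO-CLASS IDENTITY** (place-generic; from ONE match).  `v` non-split, `H′` hermitian with `det H′ ≠ 0`,
`γ_H` with `χ_{g,w}` rootless in `L_w`, `b` a match of `γ_H`.  Then there are matches `δ₊`, `δ₋` with `κ_v(γ_H, δ₊) = 1`, `κ_v(γ_H, δ₋) = −1`; every match of sign `1`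
(resp. `−1`) is conjugate to `δ₊` (resp. `δ₋`); and for EVERY orbital-measure family and EVERY `f`
`∑ᶠ c, Δ‴_v(γ_H, out c)·Φ(c, f) = τ_v(γ_H, μ)·D_v(γ_H)·(Φ(⟦δ₊⟧, f) − Φ(⟦δ₋⟧, f))`.
[cite: Rogawski1990, §4.3 (4.3.1)–(4.3.2) p. 43; §4.9 Prop. 4.9.1 (b) p. 55; §3.5 Prop. 3.5.2 (c) p. 29] [cite: Flicker1998UnitaryFL, Theorem 18 p. 97] [cite: Kottwitz1986, §7] -/
theorem exists_signedPair_finsum_delta_mul_classOrbitalIntegral_eq_mul_sub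
    (hH' : (H'.map (cmConjRingHom L))ᵀ = H') (hdet : H'.det ≠ 0) (w : PlacesOver L v) (hw : IsCMField.complexConj L • w.1 = w.1)
    [∀ γ : (cmDatum L 3 H').Local v, MeasurableSpace (((cmDatum L 3 H').Local v) ⧸ Subgroup.centralizer ({γ} : Set ((cmDatum L 3 H').Local v)))]
    (μ : HeckeCharacter L)
    (hl : ∀ (v : HeightOneSpectrum (𝓞 ↥(maximalRealSubfield L)))
      (a : ((cmDatum L 2 (Matrix.of fun i j : Fin 2 => if i.val + j.val + 1 = 2 then (1 : L) else 0)).Local v ×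
      (cmDatum L 1 (Matrix.of fun i j : Fin 1 => if i.val + j.val + 1 = 1 then (1 : L) else 0)).Local v))
      (b : (cmDatum L 3 H').Local v)
      (x : ((cmDatum L 2 (Matrix.of fun i j : Fin 2 => if i.val + j.val + 1 = 2 then (1 : L) else 0)).Local v ×
      (cmDatum L 1 (Matrix.of fun i j : Fin 1 => if i.val + j.val + 1 = 1 then (1 : L) else 0)).Local v)),
      finExplicitDelta L v H' (x * a * x⁻¹) μ b = finExplicitDelta L v H' a μ b)
    (hr : ∀ (v : HeightOneSpectrum (𝓞 ↥(maximalRealSubfield L)))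
      (a : ((cmDatum L 2 (Matrix.of fun i j : Fin 2 => if i.val + j.val + 1 = 2 then (1 : L) else 0)).Local v ×
      (cmDatum L 1 (Matrix.of fun i j : Fin 1 => if i.val + j.val + 1 = 1 then (1 : L) else 0)).Local v))
      (b y : (cmDatum L 3 H').Local v),
      finExplicitDelta L v H' a μ (y * b * y⁻¹) = finExplicitDelta L v H' a μ b)
    {γH : ((cmDatum L 2 (Matrix.of fun i j : Fin 2 => if i.val + j.val + 1 = 2 then (1 : L) else 0)).Local v ×
      (cmDatum L 1 (Matrix.of fun i j : Fin 1 => if i.val + j.val + 1 = 1 then (1 : L) else 0)).Local v)}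
    (hirr : ¬ ∃ x : w.1.adicCompletion L, (((γH.1.val : GL (Fin 2) (LocalRing L v)).val.map
        (Pi.evalRingHom (fun w' : PlacesOver L v => w'.1.adicCompletion L) w)).charpoly).IsRoot x)
    {b : (cmDatum L 3 H').Local v} (h : IsLocalNormPair L H' v γH b) :
    ∃ δp δm : (cmDatum L 3 H').Local v,
      IsLocalNormPair L H' v γH δp ∧ finKappaAt L v H' γH δp = 1 ∧ IsLocalNormPair L H' v γH δm ∧ finKappaAt L v H' γH δm = -1 ∧
      (∀ δ : (cmDatum L 3 H').Local v, IsLocalNormPair L H' v γH δ → finKappaAt L v H' γH δ = 1 → IsConj δp δ) ∧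
      (∀ δ : (cmDatum L 3 H').Local v, IsLocalNormPair L H' v γH δ → finKappaAt L v H' γH δ = -1 → IsConj δm δ) ∧
      ∀ (mG : OrbitalMeasureFamily ((cmDatum L 3 H').Local v)) (f : (cmDatum L 3 H').Local v → ℂ),
        ∑ᶠ c : ConjClasses ((cmDatum L 3 H').Local v),
            (finExplicitCollection L H' μ hl hr v).Δ γH (Quotient.out c) * classOrbitalIntegral mG f c =
          finTau L v γH μ * (finWeylRatio L v γH : ℂ) *
            (classOrbitalIntegral mG f (ConjClasses.mk δp) - classOrbitalIntegral mG f (ConjClasses.mk δm)) := by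
  -- (1) the block frame of the match, `χ_g` irreducible, `χ_g(u)` a unit, the local hermitian data
  have hA : Irreducible ((γH.1.val : GL (Fin 2) (UnitaryGroup.LocalRing L v)).val.charpoly) :=
    irreducible_charpoly_of_not_exists_isRoot_eval L v w hw _ hirr
  have hu : IsUnit ((finCharpolyTwo L v γH).eval (finGammaTwo L v γH)) := isUnit_eval_finCharpolyTwo_of_not_exists_isRoot L w hw γH hirr
  have hH := map_conjLocal_transpose_localForm L 3 H' v hH'
  have hHd := isUnit_det_localForm L 3 H' v hdet
  obtain ⟨cj, hcj⟩ := isConj_iff.1 h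
  have hP := mul_eq_mul_reindex_fromBlocks_of_conj_endoEmbLocal_eq L H' γH hcj
  -- (2) the other class and the signed pair `(δ₊, δ₋)`
  obtain ⟨δ₀, hst₀, -, hκ₀⟩ := exists_isStablyConj_finKappaAt_eq_neg L v H' γH b w hw h hu hH hHd endoPerm hP hA
  have hδ₀ : IsLocalNormPair L H' v γH δ₀ := isLocalNormPair_of_mk_mem_conjClassesIn L v H' γH b h (mk_mem_conjClassesIn_iff.2 hst₀)
  obtain ⟨δp, δm, hp, hκp, hm, hκm⟩ : ∃ δp δm : (cmDatum L 3 H').Local v,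
      IsLocalNormPair L H' v γH δp ∧ finKappaAt L v H' γH δp = 1 ∧ IsLocalNormPair L H' v γH δm ∧ finKappaAt L v H' γH δm = -1 := by
    rcases finKappaAt_eq_one_or_eq_neg_one_of_isUnit L v H' γH b h hu with hκ | hκ
    · exact ⟨b, δ₀, h, hκ, hδ₀, by rw [hκ₀, hκ]⟩
    · exact ⟨δ₀, b, hδ₀, by rw [hκ₀, hκ]; norm_num, h, hκ⟩
  -- the frames of `δ₊`, `δ₋` (for ★ `finKappaAt_eq_iff_isConj`)
  obtain ⟨cp, hcp⟩ := isConj_iff.1 hp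
  have hPp := mul_eq_mul_reindex_fromBlocks_of_conj_endoEmbLocal_eq L H' γH hcp
  obtain ⟨cm, hcm⟩ := isConj_iff.1 hm
  have hPm := mul_eq_mul_reindex_fromBlocks_of_conj_endoEmbLocal_eq L H' γH hcm
  -- same sign ⇒ same class
  have hexp : ∀ δ : (cmDatum L 3 H').Local v, IsLocalNormPair L H' v γH δ → finKappaAt L v H' γH δ = 1 → IsConj δp δ := by
    intro δ hδ hκ
    have hst : IsStablyConj (UnitaryGroup.conjLocal L (IsCMField.complexConj L) v) ((UnitaryGroup.adelicForm L 3 H').map (UnitaryGroup.adeleToLocal L v))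
        ⟨δp.val, δp.2⟩ ⟨δ.val, δ.2⟩ := by
      have h1 := hp; have h2' := hδ
      rw [isLocalNormPair_iff] at h1 h2'
      exact h1.isStablyConj_right h2'
    obtain ⟨gδ, hgδ⟩ := isStablyConj_iff.1 hst
    exact (finKappaAt_eq_iff_isConj L v H' γH δp δ w hw hp hu hH hHd endoPerm hPp hA hgδ).1 (hκ.trans hκp.symm)
  have hexm : ∀ δ : (cmDatum L 3 H').Local v, IsLocalNormPair L H' v γH δ → finKappaAt L v H' γH δ = -1 → IsConj δm δ := by
    intro δ hδ hκ
    have hst : IsStablyConj (UnitaryGroup.conjLocal L (IsCMField.complexConj L) v) ((UnitaryGroup.adelicForm L 3 H').map (UnitaryGroup.adeleToLocal L v))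
        ⟨δm.val, δm.2⟩ ⟨δ.val, δ.2⟩ := by
      have h1 := hm; have h2' := hδ
      rw [isLocalNormPair_iff] at h1 h2'
      exact h1.isStablyConj_right h2'
    obtain ⟨gδ, hgδ⟩ := isStablyConj_iff.1 hst
    exact (finKappaAt_eq_iff_isConj L v H' γH δm δ w hw hm hu hH hHd endoPerm hPm hA hgδ).1 (hκ.trans hκm.symm)
  refine ⟨δp, δm, hp, hκp, hm, hκm, hexp, hexm, fun mG f => ?_⟩
  -- (3) the values form over the frame of `b`
  exact finsum_delta_mul_classOrbitalIntegral_eq_mul_sub_of_blockFrame_of_values L v H' γH b w hw μ hl hr h hu hH hHd endoPerm hP hA mG f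
    (fun δ hδ hκ => by rw [← (ConjClasses.mk_eq_mk_iff_isConj.2 (hexp δ hδ hκ))])
    (fun δ hδ hκ => by rw [← (ConjClasses.mk_eq_mk_iff_isConj.2 (hexm δ hδ hκ))])

set_option maxHeartbeats 400000 in
open scoped Classical in
/-- **The values form keyed by `γ_H`** (no frame binder): `v` non-split, `det H′ ≠ 0`, `χ_{g,w}` rootless, `b` a match; if `Φ(⟦δ⟧, f) = X` (resp. `X′`) on every match of
sign `1` (resp. `−1`) then `∑ᶠ c, Δ‴_v(γ_H, out c)·Φ(c, f) = τ_v(γ_H, μ)·D_v(γ_H)·(X − X′)`.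
[cite: Rogawski1990, §4.3 (4.3.1)–(4.3.2) p. 43; §4.9 Prop. 4.9.1 (b) p. 55] [cite: Flicker1998UnitaryFL, Theorem 18 p. 97] -/
theorem finsum_delta_mul_classOrbitalIntegral_eq_mul_sub_of_not_exists_isRoot_of_values
    (hH' : (H'.map (cmConjRingHom L))ᵀ = H') (hdet : H'.det ≠ 0) (w : PlacesOver L v) (hw : IsCMField.complexConj L • w.1 = w.1)
    [∀ γ : (cmDatum L 3 H').Local v, MeasurableSpace (((cmDatum L 3 H').Local v) ⧸ Subgroup.centralizer ({γ} : Set ((cmDatum L 3 H').Local v)))]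
    (μ : HeckeCharacter L)
    (hl : ∀ (v : HeightOneSpectrum (𝓞 ↥(maximalRealSubfield L)))
      (a : ((cmDatum L 2 (Matrix.of fun i j : Fin 2 => if i.val + j.val + 1 = 2 then (1 : L) else 0)).Local v ×
      (cmDatum L 1 (Matrix.of fun i j : Fin 1 => if i.val + j.val + 1 = 1 then (1 : L) else 0)).Local v))
      (b : (cmDatum L 3 H').Local v)
      (x : ((cmDatum L 2 (Matrix.of fun i j : Fin 2 => if i.val + j.val + 1 = 2 then (1 : L) else 0)).Local v ×
      (cmDatum L 1 (Matrix.of fun i j : Fin 1 => if i.val + j.val + 1 = 1 then (1 : L) else 0)).Local v)),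
      finExplicitDelta L v H' (x * a * x⁻¹) μ b = finExplicitDelta L v H' a μ b)
    (hr : ∀ (v : HeightOneSpectrum (𝓞 ↥(maximalRealSubfield L)))
      (a : ((cmDatum L 2 (Matrix.of fun i j : Fin 2 => if i.val + j.val + 1 = 2 then (1 : L) else 0)).Local v ×
      (cmDatum L 1 (Matrix.of fun i j : Fin 1 => if i.val + j.val + 1 = 1 then (1 : L) else 0)).Local v))
      (b y : (cmDatum L 3 H').Local v),
      finExplicitDelta L v H' a μ (y * b * y⁻¹) = finExplicitDelta L v H' a μ b)
    {γH : ((cmDatum L 2 (Matrix.of fun i j : Fin 2 => if i.val + j.val + 1 = 2 then (1 : L) else 0)).Local v ×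
      (cmDatum L 1 (Matrix.of fun i j : Fin 1 => if i.val + j.val + 1 = 1 then (1 : L) else 0)).Local v)}
    (hirr : ¬ ∃ x : w.1.adicCompletion L, (((γH.1.val : GL (Fin 2) (LocalRing L v)).val.map
        (Pi.evalRingHom (fun w' : PlacesOver L v => w'.1.adicCompletion L) w)).charpoly).IsRoot x)
    {b : (cmDatum L 3 H').Local v} (h : IsLocalNormPair L H' v γH b)
    (mG : OrbitalMeasureFamily ((cmDatum L 3 H').Local v)) (f : (cmDatum L 3 H').Local v → ℂ) {X X' : ℂ}
    (hΦ : ∀ δ : (cmDatum L 3 H').Local v, IsLocalNormPair L H' v γH δ → finKappaAt L v H' γH δ = 1 → classOrbitalIntegral mG f (ConjClasses.mk δ) = X)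
    (hΦ' : ∀ δ : (cmDatum L 3 H').Local v, IsLocalNormPair L H' v γH δ → finKappaAt L v H' γH δ = -1 → classOrbitalIntegral mG f (ConjClasses.mk δ) = X') :
    ∑ᶠ c : ConjClasses ((cmDatum L 3 H').Local v),
        (finExplicitCollection L H' μ hl hr v).Δ γH (Quotient.out c) * classOrbitalIntegral mG f c =
      finTau L v γH μ * (finWeylRatio L v γH : ℂ) * (X - X') := by
  obtain ⟨δp, δm, hp, hκp, hm, hκm, -, -, hsum⟩ :=
    exists_signedPair_finsum_delta_mul_classOrbitalIntegral_eq_mul_sub L H' hH' hdet w hw μ hl hr hirr h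
  rw [hsum mG f, hΦ δp hp hκp, hΦ' δm hm hκm]

end Keyed

/-! ## §3 The signed pair and the two-class identity fed by the wave's frame token (over FILE 1∕2 ★ `exists_isLocalNormPair_of_frame`) -/

section FrameFed

variable (L : Type) [Field L] [NumberField L] [IsCMField L] (H' : Matrix (Fin 3) (Fin 3) L)
  {v : HeightOneSpectrum (𝓞 ↥(maximalRealSubfield L))}

set_option maxHeartbeats 400000 in
open scoped Classical in
/-- **THE SIGNED PAIR AND THE TWO-CLASS IDENTITY, FED BY THE FRAME TOKEN** (§2 ∘ `exists_isLocalNormPair_of_frame`): at a non-split `v` with the wave's frame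
`hframe`, for a type-(2) `γ_H` (`χ_{g,w}` rootless) there are matches `δ₊`, `δ₋` of signs `1`, `−1` exhausting the matches up to conjugacy, and
`∑ᶠ c, Δ‴_v(γ_H, out c)·Φ(c, f) = τ_v(γ_H, μ)·D_v(γ_H)·(Φ(⟦δ₊⟧, f) − Φ(⟦δ₋⟧, f))` for every family and every `f`.
[cite: Rogawski1990, §4.3 (4.3.1)–(4.3.2) p. 43; §4.9 Prop. 4.9.1 (b) p. 55; §3.5 Prop. 3.5.2 (c) p. 29] [cite: Flicker1998UnitaryFL, Theorem 18 p. 97] -/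
theorem exists_signedPair_finsum_delta_mul_classOrbitalIntegral_eq_mul_sub_of_frame
    (hH' : (H'.map (cmConjRingHom L))ᵀ = H') (hdet : H'.det ≠ 0) (w : PlacesOver L v) (hw : IsCMField.complexConj L • w.1 = w.1)
    (hH'w : IsUnit (placeForm H' w.1)) (A : GL (Fin 3) (w.1.adicCompletion L))
    (hframe : placeForm H' w.1 = (-(placeForm H' w.1).det) •
      formCongr (galAdicCompletionMap (L := L) (IsCMField.complexConj L) hw) A ((StdForm.antidiagonal 3).over (w.1.adicCompletion L)))
    [∀ γ : (cmDatum L 3 H').Local v, MeasurableSpace (((cmDatum L 3 H').Local v) ⧸ Subgroup.centralizer ({γ} : Set ((cmDatum L 3 H').Local v)))]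
    (μ : HeckeCharacter L)
    (hl : ∀ (v : HeightOneSpectrum (𝓞 ↥(maximalRealSubfield L)))
      (a : ((cmDatum L 2 (Matrix.of fun i j : Fin 2 => if i.val + j.val + 1 = 2 then (1 : L) else 0)).Local v ×
      (cmDatum L 1 (Matrix.of fun i j : Fin 1 => if i.val + j.val + 1 = 1 then (1 : L) else 0)).Local v))
      (b : (cmDatum L 3 H').Local v)
      (x : ((cmDatum L 2 (Matrix.of fun i j : Fin 2 => if i.val + j.val + 1 = 2 then (1 : L) else 0)).Local v ×
      (cmDatum L 1 (Matrix.of fun i j : Fin 1 => if i.val + j.val + 1 = 1 then (1 : L) else 0)).Local v)),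
      finExplicitDelta L v H' (x * a * x⁻¹) μ b = finExplicitDelta L v H' a μ b)
    (hr : ∀ (v : HeightOneSpectrum (𝓞 ↥(maximalRealSubfield L)))
      (a : ((cmDatum L 2 (Matrix.of fun i j : Fin 2 => if i.val + j.val + 1 = 2 then (1 : L) else 0)).Local v ×
      (cmDatum L 1 (Matrix.of fun i j : Fin 1 => if i.val + j.val + 1 = 1 then (1 : L) else 0)).Local v))
      (b y : (cmDatum L 3 H').Local v),
      finExplicitDelta L v H' a μ (y * b * y⁻¹) = finExplicitDelta L v H' a μ b)
    {γH : ((cmDatum L 2 (Matrix.of fun i j : Fin 2 => if i.val + j.val + 1 = 2 then (1 : L) else 0)).Local v ×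
      (cmDatum L 1 (Matrix.of fun i j : Fin 1 => if i.val + j.val + 1 = 1 then (1 : L) else 0)).Local v)}
    (hirr : ¬ ∃ x : w.1.adicCompletion L, (((γH.1.val : GL (Fin 2) (LocalRing L v)).val.map
        (Pi.evalRingHom (fun w' : PlacesOver L v => w'.1.adicCompletion L) w)).charpoly).IsRoot x) :
    ∃ δp δm : (cmDatum L 3 H').Local v,
      IsLocalNormPair L H' v γH δp ∧ finKappaAt L v H' γH δp = 1 ∧ IsLocalNormPair L H' v γH δm ∧ finKappaAt L v H' γH δm = -1 ∧
      (∀ δ : (cmDatum L 3 H').Local v, IsLocalNormPair L H' v γH δ → finKappaAt L v H' γH δ = 1 → IsConj δp δ) ∧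
      (∀ δ : (cmDatum L 3 H').Local v, IsLocalNormPair L H' v γH δ → finKappaAt L v H' γH δ = -1 → IsConj δm δ) ∧
      ∀ (mG : OrbitalMeasureFamily ((cmDatum L 3 H').Local v)) (f : (cmDatum L 3 H').Local v → ℂ),
        ∑ᶠ c : ConjClasses ((cmDatum L 3 H').Local v),
            (finExplicitCollection L H' μ hl hr v).Δ γH (Quotient.out c) * classOrbitalIntegral mG f c =
          finTau L v γH μ * (finWeylRatio L v γH : ℂ) *
            (classOrbitalIntegral mG f (ConjClasses.mk δp) - classOrbitalIntegral mG f (ConjClasses.mk δm)) := by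
  obtain ⟨b, h⟩ := exists_isLocalNormPair_of_frame L H' w hw hH'w A hframe γH
  exact exists_signedPair_finsum_delta_mul_classOrbitalIntegral_eq_mul_sub L H' hH' hdet w hw μ hl hr hirr h

end FrameFed

end Literature.NumberTheory.Rogawski1990

end
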